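import Summits.QuantumFields.YangMills.Theorems.BalabanUVNodesN15TwoGridDressedUnitLayerExactN15At
import Summits.QuantumFields.YangMills.Theorems.BalabanUVNodesN15TwoGridDressedSiteLayerFaces
import Summits.QuantumFields.YangMills.Theorems.BalabanUVNodesK3V5Stub1LetterForm
import HarnessLib

/-!
# N15 (NE2) — PROGRAMME Σ, part Σ-D: the faces of Σ-C's EXACT all-layers-U-live literal `allLayersBgExObjects` — family-keyed editions, the two `GuardedReading`-corner faces + the three
# layers of record under a PIN of the reading's NE2 objects to it (ROAD (b) drop-ins, carried as the pin BODY), and the A6 joint inhabitant of the four would-be stub-1 keys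

WHO ∕ WHEN.  Cell `pub-ymgap`, seat `pub-ymgap-dag-n15-a` (KNIT-BY-NAME seat of Track-A DAG node N15 = NE2, g28); `--kind proof --supports stmt-QuantumFields-27366 --as helper` (K3⁸;
count-neutral).  THEOREMS ONLY (0 `def`): the would-be v8 pin is carried as its BODY `∃ b ν κ α β α′ β′ c₃₅ p, 0 < b ∧ 0 < c₃₅ ∧ ∀ F θ hP g₀ os k, (𝔯.lit F θ hP g₀ os).ne2 k =
allLayersBgExObjects 3 F.hL b ν κ α β α′ β′ c₃₅ p` (ref-B g37 READ-969 INTERFACE NOTE I.44941: nine letters, row `0 < c₃₅` load-bearing; a registered v8 text would get its by-name mirror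
then, n27-w1's `K3V5Defs` pattern).  Over Σ-C `…TwoGridDressedUnitLayerExactN15At` (`allLayersBgExObjects`, `n15At_∕live_allLayersBgExObjects`), Λ-G (`three_le_blockFactor`), dag-n27-w1's
`…K3V5Defs` (`rrOfRecord`, `RunSel`, `LetterReading`, `U3PinnedKernels`) and `…K3V5Stub1LetterForm` (minting pattern `exists_reading_v5pins`), dag-n14-w1 (`Ne1PinnedOfRecord`, `ne1OfRecord`),
def-W1 ∕ module 43 (`objectsOfRecord₁₃`, `N16PinnedLoose`, `ne3ConstLayerOfRecord₁₁`), dag-n15-w2 (`Live`, `KeyedLive`), part 30 (`neZero_blockFactor`) BY NAME; nothing in the tree is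
modified; NO skeleton is touched (K3⁸ v7 HARD FREEZE, №250 (3)(e)∕(4)).

WHY.  Director-ym №250 (4): road (b) — a v8 re-pin of `N15PinnedSized` to an all-layers-background-live literal — is «a K3⁸ TEXT CHANGE, plan's call, not this generation»; ref-B g37's
(3)(c) classification on the road-(a) claim of record (I.44870) is (γ) «print's U-dependence of NE2 is carried by NO registered consumer; the (β) home exists in the tree as a FACE»
(READ-967∕968∕969).  THIS FILE makes the (β) home turnkey at the MOST HONEST literal this lane holds (Σ-C: operator, site AND unit read `U`, site∕unit at ONE exact (1.103) dressing): the
corner faces, the three layers of record, N21's keyed binder shape and the A6 inhabitant of the four keys a v8 stub 1 would carry are tree theorems.  Nothing here asks for the re-cut.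

WHAT.  §2 family-keyed Σ-C faces `n15At_∕live_∕live_and_n15At_allLayersBgExObjects_family` (`(d, L) := (3, F.L)`).  §3 under the pin BODY: ★★ `keyedLive_rrOfRecord_of_pinnedAllLayersBgEx`
(⟹ w2's `KeyedLive (rrOfRecord 𝔯 ksel)`, every selector), ★★★ **`n15At_rrOfRecord_of_pinnedAllLayersBgEx (hpin) (ksel) (F θ hP g₀ os) : N15At (rrOfRecord 𝔯 ksel F θ hP g₀ os).ne2`** (plan
g90's F1 shape with the v8 body in place of `N15PinnedSized`), `live_and_n15At_rrOfRecord_…`, `n15At_lit_of_…` (every run length), the three layers of record separately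
`ne2PlusOperator_∕ne2PlusSite_∕ne2PlusUnit_rrOfRecord_of_pinnedAllLayersBgEx`, ★★ `keyedN15_of_pinnedAllLayersBgEx` (N21's booked binder shape).  §4 ★★ `exists_reading_allLayersPins` — SOME
Stage-13 rate reading carries, JOINTLY, N14's `Ne1PinnedOfRecord`, THIS pin body, def-W1's `U3PinnedKernels · ℓ` and module 43's `N16PinnedLoose · ℓ₃ B`, for every choice of letters (the
would-be v8 stub-1 KEYS are jointly inhabited; every pin by `rfl`).

HONEST FRAMING ∕ LIMITS.  By-name bookkeeping; NO estimate.  The pinned objects are Σ-C's MODEL-LEVEL family: all three layers READ `U` = the ABELIANISED FIRST-ORDER coefficient pair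
`(c′, a′_μ)` of (3.52)'s `V′(A)`, abelianised `Q`, symmetrised exact (1.103) dressing; Bałaban's NE2 for the NON-ABELIAN dressed `G(U)` is NOT proved (lane n15-c, road (c)); this file
registers nothing, re-pins nothing, and changes no count: the N15 claim of record (I.44870) is on the v7 pin `N15PinnedSized` (road (a), label «AS CONSUMED (U-blind pin)»); K3⁸ OPEN;
counts UNMOVED (typed 28∕28 · discharged 7∕28 = 7∕27 excl. NODE O); one finite 𝕋⁴ at fixed ε — NOT ℝ⁴ ∕ infinite volume ∕ OS ∕ mass gap ∕ Clay.  No `sorry`, `instance`, `notation`,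
`maxHeartbeats`; standard axioms.
-/

noncomputable section

namespace Summit.QuantumFields.YangMills.BalabanUVNodes.N15.SiteLayerBg

open Literature.MathematicalPhysics.QuantumFieldTheory.Balaban1983to89
open Literature.MathematicalPhysics.QuantumFieldTheory.Balaban1983to89.T4Continuum (T4Family ULoop)
open Literature.MathematicalPhysics.QuantumFieldTheory.Balaban1983to89.T4EtaRate (NE2PlusOperator NE2PlusSite NE2PlusUnit)
open Node00 (Stage13HParams NE2Objects₁₁ NE3Letters₁₁ RateObjects₁₁ ne3ConstLayerOfRecord₁₁ ne3NperOfRecord₁₁ ne3DomOfRecord₁₁)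
open Literature.MathematicalPhysics.QuantumFieldTheory.Balaban1983to89.Node00.U3OfKernels (objectsOfRecord₁₃)
open Summit.QuantumFields.BalabanUV.T4Continuum.MinimalActionRate (sfClass)
open Summit.QuantumFields.YangMills.Theorems.K3V5Defs (N15PinnedSized GuardedReading rrOfRecord RunSel LetterReading U3PinnedKernels)
open Summit.QuantumFields.YangMills.BalabanUVNodes.N16PinnedLayer13CoPH (N16PinnedLoose)
open YMDAG.N14.TopBorn (Ne1PinnedOfRecord ne1OfRecord)
open Summit.QuantumFields.YangMills.BalabanUVNodes.N15.UnitLayerBg (three_le_blockFactor)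
open Summit.QuantumFields.YangMills.BalabanUVNodes.N15.AtKeyedHome (neZero_blockFactor)
open Summit.QuantumFields.YangMills.BalabanUVNodes.N15.PairedFamilyGuard (Live KeyedLive)
open YMDAG.UVSplit (N15At ne2OfRecord₁₁ RateReading₁₃CoPH rateCarriersOfRecord₁₃CoPH)

/-! ## §1 (no definition: the would-be pin is carried as its BODY — a v8 text, if ever registered, gets its by-name mirror then, n27-w1's `K3V5Defs` pattern) -/

/-! ## §2 The family-keyed Σ-C faces (`(d, L) := (3, F.L)`) -/

/-- ★★ `N15At` AT THE FAMILY-KEYED EXACT LITERAL (`b, c₃₅ > 0`). [bookkeeping] -/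
theorem n15At_allLayersBgExObjects_family {b c35 : ℝ} (hb : 0 < b) (hc35 : 0 < c35) (ν κ α β α' β' : Fin 4) (p : ℝ) (F : T4Family) :
    N15At (ne2OfRecord₁₁ (haveI := neZero_blockFactor F; allLayersBgExObjects 3 F.hL b ν κ α β α' β' c35 p)) := by
  haveI := neZero_blockFactor F
  exact n15At_allLayersBgExObjects (d := 3) (by norm_num) F.hL.1 (three_le_blockFactor F) F.hL hb hc35 ν κ α β α' β' p

/-- ★★ the family-keyed exact literal is LIVE (`c₃₅ ≥ 0`). [bookkeeping] -/
theorem live_allLayersBgExObjects_family (b : ℝ) (ν κ α β α' β' : Fin 4) {c35 : ℝ} (hc35 : 0 ≤ c35) (p : ℝ) (F : T4Family) :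
    Live (ne2OfRecord₁₁ (haveI := neZero_blockFactor F; allLayersBgExObjects 3 F.hL b ν κ α β α' β' c35 p)) := by
  haveI := neZero_blockFactor F
  exact live_allLayersBgExObjects F.hL b ν κ α β α' β' hc35 p

/-- ★★ GUARD ∧ `N15At` for the family-keyed exact literal (`b, c₃₅ > 0`). [bookkeeping] -/
theorem live_and_n15At_allLayersBgExObjects_family (F : T4Family) {b c35 : ℝ} (hb : 0 < b) (hc35 : 0 < c35) (ν κ α β α' β' : Fin 4) (p : ℝ) :
    haveI := neZero_blockFactor F
    Live (ne2OfRecord₁₁ (allLayersBgExObjects 3 F.hL b ν κ α β α' β' c35 p)) ∧ N15At (ne2OfRecord₁₁ (allLayersBgExObjects 3 F.hL b ν κ α β α' β' c35 p)) :=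
  ⟨live_allLayersBgExObjects_family b ν κ α β α' β' hc35.le p F, n15At_allLayersBgExObjects_family hb hc35 ν κ α β α' β' p F⟩

/-! ## §3 The `GuardedReading`-corner faces keyed on the would-be pin BY NAME -/

variable {𝔯 : RateReading₁₃CoPH 2}

/-- ★★ **PINNED ⟹ KEYED-LIVE, EVERY SELECTOR** (w2's `KeyedLive (rrOfRecord 𝔯 ksel)` — the `GuardedReading` second conjunct from the would-be pin). [bookkeeping] -/
theorem keyedLive_rrOfRecord_of_pinnedAllLayersBgEx (hpin : ∃ (b : ℝ) (ν κ α β α' β' : Fin 4) (c35 p : ℝ), 0 < b ∧ 0 < c35 ∧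
      ∀ (F : T4Family) (θ : Stage13HParams F 2) (hP : θ.Provisos₁₃CoPH F 2) (g₀ : ℕ → ℝ) (os : List (ULoop F)) (k : ℕ),
        (𝔯.lit F θ hP g₀ os).ne2 k = haveI := neZero_blockFactor F; allLayersBgExObjects 3 F.hL b ν κ α β α' β' c35 p) (ksel : RunSel) : KeyedLive (rrOfRecord 𝔯 ksel) := by
  obtain ⟨b, ν, κ, α, β, α', β', c35, p, -, hc35, h⟩ := hpin
  intro F θ hP _ _ g₀ os
  show Live (ne2OfRecord₁₁ ((𝔯.lit F θ hP g₀ os).ne2 (ksel F θ hP g₀ os)))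
  rw [h F θ hP g₀ os (ksel F θ hP g₀ os)]
  exact live_allLayersBgExObjects_family b ν κ α β α' β' hc35.le p F

/-- ★★★ **N15's DECL OF RECORD AT EVERY READING THE WOULD-BE v8 PIN NAMES** — plan g90's F1 shape with the would-be v8 pin BODY in place of `N15PinnedSized`: every Stage-13 tuple with core
provisos, every `(g₀, os)`, every selector; display = the pin and nothing else. [bookkeeping] -/
theorem n15At_rrOfRecord_of_pinnedAllLayersBgEx (hpin : ∃ (b : ℝ) (ν κ α β α' β' : Fin 4) (c35 p : ℝ), 0 < b ∧ 0 < c35 ∧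
      ∀ (F : T4Family) (θ : Stage13HParams F 2) (hP : θ.Provisos₁₃CoPH F 2) (g₀ : ℕ → ℝ) (os : List (ULoop F)) (k : ℕ),
        (𝔯.lit F θ hP g₀ os).ne2 k = haveI := neZero_blockFactor F; allLayersBgExObjects 3 F.hL b ν κ α β α' β' c35 p) (ksel : RunSel)
    (F : T4Family) (θ : Stage13HParams F 2) (hP : θ.Provisos₁₃CoPH F 2) (g₀ : ℕ → ℝ) (os : List (ULoop F)) :
    N15At (rrOfRecord 𝔯 ksel F θ hP g₀ os).ne2 := by
  obtain ⟨b, ν, κ, α, β, α', β', c35, p, hb, hc35, h⟩ := hpin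
  show N15At (ne2OfRecord₁₁ ((𝔯.lit F θ hP g₀ os).ne2 (ksel F θ hP g₀ os)))
  rw [h F θ hP g₀ os (ksel F θ hP g₀ os)]
  exact n15At_allLayersBgExObjects_family hb hc35 ν κ α β α' β' p F

/-- `Live ∧ N15At` at every bundle of record under the would-be pin. [bookkeeping] -/
theorem live_and_n15At_rrOfRecord_of_pinnedAllLayersBgEx (hpin : ∃ (b : ℝ) (ν κ α β α' β' : Fin 4) (c35 p : ℝ), 0 < b ∧ 0 < c35 ∧
      ∀ (F : T4Family) (θ : Stage13HParams F 2) (hP : θ.Provisos₁₃CoPH F 2) (g₀ : ℕ → ℝ) (os : List (ULoop F)) (k : ℕ),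
        (𝔯.lit F θ hP g₀ os).ne2 k = haveI := neZero_blockFactor F; allLayersBgExObjects 3 F.hL b ν κ α β α' β' c35 p) (ksel : RunSel)
    (F : T4Family) (θ : Stage13HParams F 2) (hP : θ.Provisos₁₃CoPH F 2) (g₀ : ℕ → ℝ) (os : List (ULoop F)) :
    Live (rrOfRecord 𝔯 ksel F θ hP g₀ os).ne2 ∧ N15At (rrOfRecord 𝔯 ksel F θ hP g₀ os).ne2 := by
  obtain ⟨b, ν, κ, α, β, α', β', c35, p, hb, hc35, h⟩ := hpin
  show Live (ne2OfRecord₁₁ ((𝔯.lit F θ hP g₀ os).ne2 (ksel F θ hP g₀ os))) ∧ N15At (ne2OfRecord₁₁ ((𝔯.lit F θ hP g₀ os).ne2 (ksel F θ hP g₀ os)))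
  rw [h F θ hP g₀ os (ksel F θ hP g₀ os)]
  exact live_and_n15At_allLayersBgExObjects_family F hb hc35 ν κ α β α' β' p

/-- `N15At` at EVERY run length of the pinned reading's literal. [bookkeeping] -/
theorem n15At_lit_of_pinnedAllLayersBgEx (hpin : ∃ (b : ℝ) (ν κ α β α' β' : Fin 4) (c35 p : ℝ), 0 < b ∧ 0 < c35 ∧
      ∀ (F : T4Family) (θ : Stage13HParams F 2) (hP : θ.Provisos₁₃CoPH F 2) (g₀ : ℕ → ℝ) (os : List (ULoop F)) (k : ℕ),
        (𝔯.lit F θ hP g₀ os).ne2 k = haveI := neZero_blockFactor F; allLayersBgExObjects 3 F.hL b ν κ α β α' β' c35 p)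
    (F : T4Family) (θ : Stage13HParams F 2) (hP : θ.Provisos₁₃CoPH F 2) (g₀ : ℕ → ℝ) (os : List (ULoop F)) (k : ℕ) :
    N15At (ne2OfRecord₁₁ ((𝔯.lit F θ hP g₀ os).ne2 k)) := by
  obtain ⟨b, ν, κ, α, β, α', β', c35, p, hb, hc35, h⟩ := hpin
  rw [h F θ hP g₀ os k]
  exact n15At_allLayersBgExObjects_family hb hc35 ν κ α β α' β' p F

/-- The FIRST layer of record under the would-be pin: `NE2PlusOperator` BY NAME (all four (3.42) entries read `U`, Λ-C). [bookkeeping] -/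
theorem ne2PlusOperator_rrOfRecord_of_pinnedAllLayersBgEx (hpin : ∃ (b : ℝ) (ν κ α β α' β' : Fin 4) (c35 p : ℝ), 0 < b ∧ 0 < c35 ∧
      ∀ (F : T4Family) (θ : Stage13HParams F 2) (hP : θ.Provisos₁₃CoPH F 2) (g₀ : ℕ → ℝ) (os : List (ULoop F)) (k : ℕ),
        (𝔯.lit F θ hP g₀ os).ne2 k = haveI := neZero_blockFactor F; allLayersBgExObjects 3 F.hL b ν κ α β α' β' c35 p) (ksel : RunSel)
    (F : T4Family) (θ : Stage13HParams F 2) (hP : θ.Provisos₁₃CoPH F 2) (g₀ : ℕ → ℝ) (os : List (ULoop F)) :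
    NE2PlusOperator (rrOfRecord 𝔯 ksel F θ hP g₀ os).ne2.c35 (rrOfRecord 𝔯 ksel F θ hP g₀ os).ne2.pi (rrOfRecord 𝔯 ksel F θ hP g₀ os).ne2.Kop :=
  (n15At_rrOfRecord_of_pinnedAllLayersBgEx hpin ksel F θ hP g₀ os).1

/-- The SECOND layer of record under the would-be pin: `NE2PlusSite 4 p` BY NAME (the site kernel reads `U`, Σ-A). [bookkeeping] -/
theorem ne2PlusSite_rrOfRecord_of_pinnedAllLayersBgEx (hpin : ∃ (b : ℝ) (ν κ α β α' β' : Fin 4) (c35 p : ℝ), 0 < b ∧ 0 < c35 ∧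
      ∀ (F : T4Family) (θ : Stage13HParams F 2) (hP : θ.Provisos₁₃CoPH F 2) (g₀ : ℕ → ℝ) (os : List (ULoop F)) (k : ℕ),
        (𝔯.lit F θ hP g₀ os).ne2 k = haveI := neZero_blockFactor F; allLayersBgExObjects 3 F.hL b ν κ α β α' β' c35 p) (ksel : RunSel)
    (F : T4Family) (θ : Stage13HParams F 2) (hP : θ.Provisos₁₃CoPH F 2) (g₀ : ℕ → ℝ) (os : List (ULoop F)) :
    NE2PlusSite 4 (rrOfRecord 𝔯 ksel F θ hP g₀ os).ne2.p (rrOfRecord 𝔯 ksel F θ hP g₀ os).ne2.c35 (rrOfRecord 𝔯 ksel F θ hP g₀ os).ne2.pi (rrOfRecord 𝔯 ksel F θ hP g₀ os).ne2.Ksite :=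
  (n15At_rrOfRecord_of_pinnedAllLayersBgEx hpin ksel F θ hP g₀ os).2.1

/-- The THIRD layer of record under the would-be pin: `NE2PlusUnit` BY NAME (the unit kernel reads `U` through the exact dressing, Σ-C). [bookkeeping] -/
theorem ne2PlusUnit_rrOfRecord_of_pinnedAllLayersBgEx (hpin : ∃ (b : ℝ) (ν κ α β α' β' : Fin 4) (c35 p : ℝ), 0 < b ∧ 0 < c35 ∧
      ∀ (F : T4Family) (θ : Stage13HParams F 2) (hP : θ.Provisos₁₃CoPH F 2) (g₀ : ℕ → ℝ) (os : List (ULoop F)) (k : ℕ),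
        (𝔯.lit F θ hP g₀ os).ne2 k = haveI := neZero_blockFactor F; allLayersBgExObjects 3 F.hL b ν κ α β α' β' c35 p) (ksel : RunSel)
    (F : T4Family) (θ : Stage13HParams F 2) (hP : θ.Provisos₁₃CoPH F 2) (g₀ : ℕ → ℝ) (os : List (ULoop F)) :
    NE2PlusUnit (rrOfRecord 𝔯 ksel F θ hP g₀ os).ne2.c35 (rrOfRecord 𝔯 ksel F θ hP g₀ os).ne2.pi (rrOfRecord 𝔯 ksel F θ hP g₀ os).ne2.Kunit
      (rrOfRecord 𝔯 ksel F θ hP g₀ os).ne2.inΛ (rrOfRecord 𝔯 ksel F θ hP g₀ os).ne2.unitDist :=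
  (n15At_rrOfRecord_of_pinnedAllLayersBgEx hpin ksel F θ hP g₀ os).2.2

/-- ★★ THE KEYED N15 ROW FROM THE WOULD-BE PIN (N21's booked binder shape). [bookkeeping] -/
theorem keyedN15_of_pinnedAllLayersBgEx (hpin : ∃ (b : ℝ) (ν κ α β α' β' : Fin 4) (c35 p : ℝ), 0 < b ∧ 0 < c35 ∧
      ∀ (F : T4Family) (θ : Stage13HParams F 2) (hP : θ.Provisos₁₃CoPH F 2) (g₀ : ℕ → ℝ) (os : List (ULoop F)) (k : ℕ),
        (𝔯.lit F θ hP g₀ os).ne2 k = haveI := neZero_blockFactor F; allLayersBgExObjects 3 F.hL b ν κ α β α' β' c35 p) (ksel : RunSel) :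
    ∀ (F : T4Family) (θ : Stage13HParams F 2) (hP : θ.Provisos₁₃CoPH F 2), (θ.ZhUnity F 2 ∧ θ.SlotsNondegenerate₁₃ F 2) → θ.Admissible F 2 →
      ∀ (g₀ : ℕ → ℝ) (os : List (ULoop F)), N15At (rrOfRecord 𝔯 ksel F θ hP g₀ os).ne2 :=
  fun F θ hP _ _ g₀ os => n15At_rrOfRecord_of_pinnedAllLayersBgEx hpin ksel F θ hP g₀ os

/-! ## §4 A6: the four would-be stub-1 keys are jointly inhabited -/

/-- ★★ **THE ALL-PINS READING WITH THE U-LIVE N15 SLOT EXISTS, FOR EVERY CHOICE OF LETTERS** (`0 < l₀`, `0 ≤ Λ`, `0 < b`, `0 < c₃₅`): SOME Stage-13 rate reading carries JOINTLY N14's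
`Ne1PinnedOfRecord`, the would-be pin BODY (NE2 slot = `allLayersBgExObjects`), def-W1's `U3PinnedKernels · ℓ` and module 43's `N16PinnedLoose · ℓ₃ B` — n27-w1's `exists_reading_v5pins` minting with the NE2
slot `allLayersBgExObjects`; every pin by `rfl`.  Nothing estimated. [bookkeeping] -/
theorem exists_reading_allLayersPins (l₀ Λ b : ℝ) (ν κ α β α' β' : Fin 4) (c35 p : ℝ) (ℓ : LetterReading) (ℓ₃ : T4Family → NE3Letters₁₁) (B : T4Family → ℝ)
    (hl₀ : 0 < l₀) (hΛ : 0 ≤ Λ) (hb : 0 < b) (hc35 : 0 < c35) :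
    ∃ 𝔯 : RateReading₁₃CoPH 2, Ne1PinnedOfRecord 𝔯 ∧
      (∃ (b : ℝ) (ν κ α β α' β' : Fin 4) (c35 p : ℝ), 0 < b ∧ 0 < c35 ∧
        ∀ (F : T4Family) (θ : Stage13HParams F 2) (hP : θ.Provisos₁₃CoPH F 2) (g₀ : ℕ → ℝ) (os : List (ULoop F)) (k : ℕ),
          (𝔯.lit F θ hP g₀ os).ne2 k = haveI := neZero_blockFactor F; allLayersBgExObjects 3 F.hL b ν κ α β α' β' c35 p) ∧
      U3PinnedKernels 𝔯 ℓ ∧ N16PinnedLoose 𝔯 ℓ₃ B := by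
  let lit : (F : T4Family) → (θ : Stage13HParams F 2) → θ.Provisos₁₃CoPH F 2 → (ℕ → ℝ) → List (ULoop F) → RateObjects₁₁ 2 :=
    fun F θ _ _ _ =>
      ⟨objectsOfRecord₁₃ F 2 θ.toStage13Params (ℓ F θ),
        fun _ => { ne3ConstLayerOfRecord₁₁ F 2 (ℓ₃ F) with
          dom := {V | V ∈ ne3DomOfRecord₁₁ F 2 0 0 ∧ V ∈ sfClass 4 F.L (ne3NperOfRecord₁₁ F 0 0) ((ℓ₃ F).ε / B F) 0} },
        fun _ => haveI := neZero_blockFactor F; allLayersBgExObjects 3 F.hL b ν κ α β α' β' c35 p⟩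
  refine ⟨⟨lit, ne1OfRecord l₀ Λ⟩, ⟨l₀, Λ, hl₀, hΛ, fun _ _ _ _ _ => rfl⟩, ⟨b, ν, κ, α, β, α', β', c35, p, hb, hc35, fun _ _ _ _ _ _ => rfl⟩,
    fun _ _ _ _ _ => rfl, fun _ _ _ _ _ _ => rfl⟩

end Summit.QuantumFields.YangMills.BalabanUVNodes.N15.SiteLayerBg

end
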